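import Summits.AnomalousDissipation.AnomalousDissipation.Theorems.SteadyCoherentFractionRootsPlanarBeyondFiniteModesRefutation
import Literature.Analysis.FluidPDE.PassiveVectorTensorTranslate
import Literature.Analysis.FluidPDE.LerayHopfGalileanTorusTools
import HarnessLib

/-!
# The horizontal translation orbit of the crossed-shear root (negative lane of
# `CoherentFraction.InvariantExtremeClimatesPlanar`, stmt-AnomalousDissipation-28074)

The crossed-shear / reciprocal-shear root `v` of `…Theorems.CrossedShearRoot` (Euler + drift
`m = c_K e₁` + Kolmogorov force `f_K = sin(4πx₁) e₀` on `T³`) is carried by the horizontal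
translations `τ_a`, `a = (s₀, 0, s₁)`, to roots of the SAME system (the force depends on `x₁`
only). This file records the translates `vshift a = v(· + a)`, the continuous orbit map
`orb : T² → H` into the energy space, the orbit climate `orbMeasure = orb_* Haar(T²)`, and the
three pointwise facts every state of the orbit inherits from `v`: the cylindrical root identity,
the planar-symmetry defect `≥ c_K²/16` in every horizontal lattice direction, and infinite Fourier
type. [folklore]
-/

noncomputable section

set_option linter.dupNamespace false

namespace Summit.AnomalousDissipation.AnomalousDissipation.Theorems.CrossedShearOrbit

open Real MeasureTheory Filter Topology
open scoped InnerProductSpace ENNReal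
open Literature.Analysis.FunctionSpaces Literature.Analysis.FunctionSpaces.Torus Literature.Analysis.FluidPDE
open Summit.AnomalousDissipation.AnomalousDissipation.Theorems.CrossedShearRoot

local notation "𝕋³" => UnitAddTorus (Fin 3)
local notation "𝕋²" => UnitAddTorus (Fin 2)
local notation "E³" => EuclideanSpace ℝ (Fin 3)

/-! ## Horizontal translations -/

/-- The horizontal embedding `T² → T³`, `(s₀, s₁) ↦ (s₀, 0, s₁)`. [folklore] -/
def hvec (s : 𝕋²) : 𝕋³ := ![s 0, 0, s 1]

/-- `hvec s 0 = s 0`. [folklore] -/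
@[simp] theorem hvec_apply_zero (s : 𝕋²) : hvec s 0 = s 0 := rfl
/-- `hvec s 1 = 0`. [folklore] -/
@[simp] theorem hvec_apply_one (s : 𝕋²) : hvec s 1 = 0 := rfl
/-- `hvec s 2 = s 1`. [folklore] -/
@[simp] theorem hvec_apply_two (s : 𝕋²) : hvec s 2 = s 1 := rfl

/-- `hvec` is additive. [folklore] -/
theorem hvec_add (s t : 𝕋²) : hvec (s + t) = hvec s + hvec t := by
  ext i
  fin_cases i <;> simp [hvec]

/-- `hvec` is continuous. [folklore] -/
theorem continuous_hvec : Continuous hvec := by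
  refine continuous_pi fun i => ?_
  fin_cases i
  · simpa [hvec] using continuous_apply (0 : Fin 2)
  · simpa [hvec] using continuous_const
  · simpa [hvec] using continuous_apply (1 : Fin 2)

/-- The translate `v(· + a)` of the crossed-shear root. [folklore] -/
def vshift (a : 𝕋³) : 𝕋³ → E³ := fun x => vfield (x + a)

/-- Unfolding `vshift`. [folklore] -/
theorem vshift_apply (a x : 𝕋³) : vshift a x = vfield (x + a) := rfl

/-- Translates are smooth. [folklore] -/
theorem isSmooth_vshift (a : 𝕋³) : IsSmooth (vshift a) := isSmooth_vfield.comp_add_right a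

/-- Translates are divergence free. [folklore] -/
theorem isDivFree_vshift (a : 𝕋³) : IsDivFree (vshift a) := isDivFree_vfield.translate a

/-- Translates have zero mean. [folklore] -/
theorem hasZeroMean_vshift (a : 𝕋³) : HasZeroMean (vshift a) := by
  unfold HasZeroMean vshift
  rw [integral_add_right_eq_self vfield a]
  exact hasZeroMean_vfield

/-- The force is invariant under horizontal translations (it depends on `x₁` only). [folklore] -/
theorem fK_add_hvec (x : 𝕋³) (s : 𝕋²) : fK (x + hvec s) = fK x := by
  have h1 : UnitAddTorus.mFourier (![0, 2, 0] : Fin 3 → ℤ) (hvec s) = 1 := by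
    simp [UnitAddTorus.mFourier, Fin.prod_univ_three, hvec]
  simp only [fK, Torus.stokesMode_apply, mFourier_apply_add, h1, mul_one]

/-- **Root identity along the orbit.** Every state represented by a horizontal translate of `v` is a
cylindrical root: `(f_K, w) + (W, (m·∇)w) + ∫⟪(W·∇)w, W⟫ = 0` for all smooth divergence-free `w`
(translate the test field back, use the root identity of `v`, and the invariance of `f_K`). [folklore] -/
theorem root_identity_shift (s : 𝕋²) {W : 𝕋³ → E³} (hW : W =ᵐ[volume] vshift (hvec s))
    {w : 𝕋³ → E³} (hw : IsSmooth w) (hwd : IsDivFree w) :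
    (∫ x, ⟪fK x, w x⟫_ℝ) + (∫ x, ⟪W x, Torus.fderiv w x drift⟫_ℝ) +
      (∫ x, ⟪Torus.fderiv w x (W x), W x⟫_ℝ) = 0 := by
  set a : 𝕋³ := hvec s with ha
  have e1 : ∫ x, ⟪W x, Torus.fderiv w x drift⟫_ℝ = ∫ x, ⟪vshift a x, Torus.fderiv w x drift⟫_ℝ :=
    integral_congr_ae (by filter_upwards [hW] with x hx; rw [hx])
  have e2 : ∫ x, ⟪Torus.fderiv w x (W x), W x⟫_ℝ = ∫ x, ⟪Torus.fderiv w x (vshift a x), vshift a x⟫_ℝ :=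
    integral_congr_ae (by filter_upwards [hW] with x hx; rw [hx])
  rw [e1, e2]
  -- the back-translated test field
  set w' : 𝕋³ → E³ := fun x => w (x + -a) with hw'_def
  have hw' : IsSmooth w' := hw.comp_add_right (-a)
  have hwd' : IsDivFree w' := hwd.translate (-a)
  have h := root_identity (W := vfield) EventuallyEq.rfl hw' hwd'
  have i1 : ∫ x, ⟪fK x, w' x⟫_ℝ = ∫ x, ⟪fK x, w x⟫_ℝ := by
    rw [← integral_add_right_eq_self (μ := volume) (fun x => ⟪fK x, w' x⟫_ℝ) a]
    refine integral_congr_ae (ae_of_all _ fun x => ?_)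
    simp only [hw'_def, ha, fK_add_hvec, add_neg_cancel_right]
  have i2 : ∫ x, ⟪vfield x, Torus.fderiv w' x drift⟫_ℝ = ∫ x, ⟪vshift a x, Torus.fderiv w x drift⟫_ℝ := by
    rw [← integral_add_right_eq_self (μ := volume) (fun x => ⟪vfield x, Torus.fderiv w' x drift⟫_ℝ) a]
    refine integral_congr_ae (ae_of_all _ fun x => ?_)
    simp only [hw'_def, vshift, fderiv_translate w (-a) (x + a), add_neg_cancel_right]
  have i3 : ∫ x, ⟪Torus.fderiv w' x (vfield x), vfield x⟫_ℝ =
      ∫ x, ⟪Torus.fderiv w x (vshift a x), vshift a x⟫_ℝ := by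
    rw [← integral_add_right_eq_self (μ := volume) (fun x => ⟪Torus.fderiv w' x (vfield x), vfield x⟫_ℝ) a]
    refine integral_congr_ae (ae_of_all _ fun x => ?_)
    simp only [hw'_def, vshift, fderiv_translate w (-a) (x + a), add_neg_cancel_right]
  rw [i1, i2, i3] at h
  exact h

/-- Defect integrals of states on the orbit are those of `v`. [folklore] -/
theorem integral_increment_sq_shift (s : 𝕋²) {W : 𝕋³ → E³} (hW : W =ᵐ[volume] vshift (hvec s)) (h : 𝕋³) :
    ∫ x, ‖W (x + h) - W x‖ ^ 2 = ∫ x, ‖vfield (x + h) - vfield x‖ ^ 2 := by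
  have hsh : (fun x => W (x + h)) =ᵐ[volume] fun x => vshift (hvec s) (x + h) :=
    (measurePreserving_add_right volume h).quasiMeasurePreserving.ae_eq_comp hW
  calc ∫ x, ‖W (x + h) - W x‖ ^ 2 = ∫ x, ‖vshift (hvec s) (x + h) - vshift (hvec s) x‖ ^ 2 :=
        integral_congr_ae (by filter_upwards [hW, hsh] with x hx hxh; rw [hx, hxh])
    _ = ∫ x, ‖vfield (x + h) - vfield x‖ ^ 2 := by
        rw [← integral_add_right_eq_self (μ := volume) (fun x => ‖vfield (x + h) - vfield x‖ ^ 2) (hvec s)]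
        refine integral_congr_ae (ae_of_all _ fun x => ?_)
        simp only [vshift, add_right_comm]

/-- **States on the orbit are not planar**: defect `≥ c_K²/16` in every horizontal lattice direction. [folklore] -/
theorem defect_shift_ge (s : 𝕋²) {W : 𝕋³ → E³} (hW : W =ᵐ[volume] vshift (hvec s)) (p : {p : ℤ × ℤ // p ≠ 0}) :
    cK ^ 2 / 16 ≤ (1 / 2 : ℝ) * ∫ t in (0 : ℝ)..1, ∫ x, ‖W (x + Literature.Analysis.FluidPDE.toTorus
      (fun i => t * (![((p.1.1 : ℤ) : ℝ), 0, ((p.1.2 : ℤ) : ℝ)] : Fin 3 → ℝ) i)) - W x‖ ^ 2 := by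
  have hp : (p.1.1, p.1.2) ≠ (0, 0) := by
    obtain ⟨⟨a, b⟩, hab⟩ := p
    simpa using hab
  have h := defect_vfield_ge p.1.1 p.1.2 hp
  simp_rw [integral_increment_sq_shift s hW]
  exact h

/-- Fourier truncation commutes with translation. [folklore] -/
theorem fourierTruncate_comp_add_right (N : ℕ) (u : 𝕋³ → E³) (b : 𝕋³) :
    fourierTruncate N (fun x => u (x + b)) = fun x => fourierTruncate N u (x + b) := by
  funext x
  simp only [fourierTruncate_eq, realTrigPoly_apply, trigPoly_apply]
  congr 1
  refine Finset.sum_congr rfl fun k _ => ?_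
  rw [show (EuclideanSpace.complexify ∘ fun x => u (x + b)) = fun x => (EuclideanSpace.complexify ∘ u) (x + b)
      from rfl, mFourierCoeff_comp_add_right, smul_smul, mFourier_apply_add, mul_comm]

/-- **States on the orbit have infinite Fourier type.** [folklore] -/
theorem not_isFiniteType_shift (a : 𝕋³) {W : 𝕋³ → E³} (hW : W =ᵐ[volume] vshift a) (N : ℕ) :
    ¬ (W =ᵐ[volume] fourierTruncate N W) := by
  intro hT
  set W' : 𝕋³ → E³ := fun x => W (x + -a) with hW'_def
  have hq := (measurePreserving_add_right (volume : Measure 𝕋³) (-a)).quasiMeasurePreserving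
  have hW' : W' =ᵐ[volume] vfield := by
    have h1 : W' =ᵐ[volume] fun x => vshift a (x + -a) := hq.ae_eq_comp hW
    refine h1.trans (ae_of_all _ fun x => ?_)
    simp only [vshift, neg_add_cancel_right]
  have hT' : W' =ᵐ[volume] fourierTruncate N W' := by
    have h1 : W' =ᵐ[volume] fun x => fourierTruncate N W (x + -a) := hq.ae_eq_comp hT
    rw [hW'_def, fourierTruncate_comp_add_right]
    exact h1
  exact not_isFiniteType hW' N hT'

/-! ## The orbit map into the energy space -/

/-- Joint continuity of `(s, x) ↦ v(x + hvec s)`. [folklore] -/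
theorem continuous_vshift_uncurry : Continuous fun p : 𝕋² × 𝕋³ => vfield (p.2 + hvec p.1) :=
  isSmooth_vfield.continuous.comp (continuous_snd.add (continuous_hvec.comp continuous_fst))

/-- The orbit as a continuous map `T² → C(T³, ℝ³)`. [folklore] -/
def orbC : C(𝕋², C(𝕋³, E³)) :=
  ContinuousMap.curry ⟨fun p : 𝕋² × 𝕋³ => vfield (p.2 + hvec p.1), continuous_vshift_uncurry⟩

/-- Unfolding `orbC`. [folklore] -/
theorem orbC_apply (s : 𝕋²) (x : 𝕋³) : orbC s x = vshift (hvec s) x := rfl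

/-- The orbit in `L²`. [folklore] -/
def orbLp (s : 𝕋²) : Lp E³ 2 (volume : Measure 𝕋³) :=
  ContinuousMap.toLp (E := E³) 2 volume ℝ (orbC s)

/-- The `L²` orbit is continuous. [folklore] -/
theorem continuous_orbLp : Continuous orbLp :=
  (ContinuousMap.toLp (E := E³) 2 volume ℝ).continuous.comp orbC.continuous

/-- `orbLp s` is represented by `v(· + hvec s)`. [folklore] -/
theorem coeFn_orbLp (s : 𝕋²) : (orbLp s : 𝕋³ → E³) =ᵐ[volume] vshift (hvec s) :=
  ContinuousMap.coeFn_toLp (E := E³) volume (orbC s)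

/-- The `L²` orbit lies in the energy space `H`. [folklore] -/
theorem orbLp_mem (s : 𝕋²) : orbLp s ∈ energySpace (Fin 3) :=
  smoothSolenoidal_subset_energySpace
    ⟨vshift (hvec s), isSmooth_vshift _, isDivFree_vshift _, hasZeroMean_vshift _, coeFn_orbLp s⟩

/-- **The orbit map** `orb : T² → H`, `s ↦ [v(· + (s₀, 0, s₁))]`. [folklore] -/
def orb (s : 𝕋²) : energySpace (Fin 3) := ⟨orbLp s, orbLp_mem s⟩

/-- The orbit map is continuous. [folklore] -/
theorem continuous_orb : Continuous orb := continuous_orbLp.subtype_mk _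

/-- The orbit map is measurable. [folklore] -/
theorem measurable_orb : Measurable orb := continuous_orb.measurable

/-- `orb s` is represented by `v(· + hvec s)`. [folklore] -/
theorem coe_orb (s : 𝕋²) :
    ((orb s : Lp E³ 2 (volume : Measure 𝕋³)) : 𝕋³ → E³) =ᵐ[volume] vshift (hvec s) :=
  coeFn_orbLp s

/-- The enstrophy is constant along the orbit. [folklore] -/
theorem eGradNormSq_orb (s : 𝕋²) :
    eGradNormSq ((orb s : Lp E³ 2 (volume : Measure 𝕋³)) : 𝕋³ → E³) = eGradNormSq vfield := by
  rw [eGradNormSq_congr_ae (coe_orb s)]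
  exact Torus.eGradNormSq_comp_add_right isSmooth_vfield.integrable (hvec s)

/-- The enstrophy of `v` is finite. [folklore] -/
theorem eGradNormSq_vfield_lt_top : eGradNormSq vfield < ⊤ := by
  obtain ⟨W, hW, hV⟩ := exists_state
  rw [← eGradNormSq_congr_ae hW]
  exact eGradNormSq_lt_top_of_memSobolev_one hV.2

/-- The enstrophy level `R₀ = ‖∇v‖₂²` of the orbit. [folklore] -/
def R0 : ℝ := (eGradNormSq vfield).toReal

/-- `‖∇v‖₂² = R₀` in `ℝ≥0∞`. [folklore] -/
theorem eGradNormSq_vfield_eq : eGradNormSq vfield = ENNReal.ofReal R0 :=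
  (ENNReal.ofReal_toReal eGradNormSq_vfield_lt_top.ne).symm

/-! ## The orbit climate -/

/-- **The orbit climate** `μ = orb_* Haar(T²)`: the uniform distribution on the horizontal
translation orbit of the crossed-shear root. [folklore] -/
def orbMeasure : Measure (energySpace (Fin 3)) := Measure.map orb volume

/-- The orbit climate is a probability measure. [folklore] -/
instance isProbabilityMeasure_orbMeasure : IsProbabilityMeasure orbMeasure :=
  Measure.isProbabilityMeasure_map measurable_orb.aemeasurable

/-- A property holding at every point of the orbit holds `μ`-a.e. (the range of `orb` is compact,
hence measurable, and carries `μ`). [folklore] -/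
theorem ae_orbMeasure_of_forall {P : energySpace (Fin 3) → Prop} (h : ∀ s, P (orb s)) :
    ∀ᵐ w ∂orbMeasure, P w := by
  have hc : IsClosed (Set.range orb) := (isCompact_range continuous_orb).isClosed
  have hnull : orbMeasure (Set.range orb)ᶜ = 0 := by
    rw [orbMeasure, Measure.map_apply measurable_orb hc.measurableSet.compl]
    have : orb ⁻¹' (Set.range orb)ᶜ = ∅ := by
      ext s
      simp
    rw [this, measure_empty]
  rw [ae_iff]
  refine measure_mono_null (fun w hw => ?_) hnull
  rintro ⟨s, rfl⟩
  exact hw (h s)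

/-- A `μ`-a.e. property holds at almost every point of the orbit. [folklore] -/
theorem ae_of_ae_orbMeasure {P : energySpace (Fin 3) → Prop} (h : ∀ᵐ w ∂orbMeasure, P w) :
    ∀ᵐ s ∂(volume : Measure 𝕋²), P (orb s) :=
  ae_of_ae_map measurable_orb.aemeasurable h

/-- A `μ`-a.e. property holds at some point of the orbit. [folklore] -/
theorem exists_of_ae_orbMeasure {P : energySpace (Fin 3) → Prop} (h : ∀ᵐ w ∂orbMeasure, P w) :
    ∃ s : 𝕋², P (orb s) :=
  (ae_of_ae_orbMeasure h).exists

/-- The orbit climate has enstrophy `≤ R₀` a.e. (in fact `= R₀` everywhere on the orbit). [folklore] -/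
theorem ae_eGradNormSq_le :
    ∀ᵐ w ∂orbMeasure, eGradNormSq (((w : energySpace (Fin 3)) : Lp E³ 2 (volume : Measure 𝕋³)) : 𝕋³ → E³) ≤ ENNReal.ofReal R0 :=
  ae_orbMeasure_of_forall fun s => by rw [eGradNormSq_orb, eGradNormSq_vfield_eq]

/-- **The orbit climate is not of finite Fourier type.** [folklore] -/
theorem not_finiteType :
    ¬ (∃ N : ℕ, ∀ᵐ w ∂orbMeasure, (((w : energySpace (Fin 3)) : Lp E³ 2 (volume : Measure 𝕋³)) : 𝕋³ → E³) =ᵐ[volume]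
      fourierTruncate N (((w : energySpace (Fin 3)) : Lp E³ 2 (volume : Measure 𝕋³)) : 𝕋³ → E³)) := by
  rintro ⟨N, hN⟩
  obtain ⟨s, hs⟩ := exists_of_ae_orbMeasure hN
  exact not_isFiniteType_shift (hvec s) (coe_orb s) N hs

/-- **The orbit climate is nowhere planar**: the planar-symmetry defect infimum is NOT `0` a.e.
(it is `≥ c_K²/16` at every state of the orbit). [folklore] -/
theorem not_ae_defect_zero :
    ¬ (∀ᵐ w ∂orbMeasure, (⨅ p : {p : ℤ × ℤ // p ≠ 0}, (1 / 2 : ℝ) * ∫ t in (0 : ℝ)..1, ∫ x,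
      ‖(((w : energySpace (Fin 3)) : Lp E³ 2 (volume : Measure 𝕋³)) : 𝕋³ → E³) (x + Literature.Analysis.FluidPDE.toTorus
        (fun i => t * (![((p.1.1 : ℤ) : ℝ), 0, ((p.1.2 : ℤ) : ℝ)] : Fin 3 → ℝ) i)) -
        (((w : energySpace (Fin 3)) : Lp E³ 2 (volume : Measure 𝕋³)) : 𝕋³ → E³) x‖ ^ 2) = 0) := by
  intro h
  obtain ⟨s, hs⟩ := exists_of_ae_orbMeasure h
  haveI : Nonempty {p : ℤ × ℤ // p ≠ 0} := ⟨⟨(1, 0), by simp⟩⟩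
  have hge := le_ciInf fun p => defect_shift_ge s (coe_orb s) p
  rw [hs] at hge
  exact absurd hge (not_le.mpr cK_sq_div_pos)

end Summit.AnomalousDissipation.AnomalousDissipation.Theorems.CrossedShearOrbit

end
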